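import Summits.Ventures.QEC.Census.GB.GB126k28.Distance
import Summits.Ventures.QEC.Census.BB.BBRows
import Summits.Ventures.QEC.Census.BB.Claims
import Literature.InformationTheory.QuantumCodes.GeneralizedBicycleCodesPK21
import Literature.InformationTheory.QuantumCodes.TwoBlockCodeEquivalences
import Literature.InformationTheory.QuantumCodes.CSSParameters
import HarnessLib

/-!
# Panteleev–Kalachev Table-1 row A2 `[[126, 28, 8]]` holds for the TYPED object `BB.pk21A2` (tier KERNEL, distance EXACT)

`BB.pk21A2 : BB.Code 63 1` is the generalized-bicycle code `GB(a, b)`, `ℓ = 63`, `a(x) = 1 + x + x¹⁴ + x¹⁶ + x²²`,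
`b(x) = 1 + x³ + x¹³ + x²⁰ + x⁴²` of [PanteleevKalachev2021, App. B] typed in
`Literature/InformationTheory/QuantumCodes/GeneralizedBicycleCodesPK21.lean` (printed row: Table 1 A2, `[[126,28,8]]`, `w = 10`; the
printed `8` was «found by an exhaustive search», PK21q arXiv:1904.02703 p0011 L43).  The census certified an explicit-matrix
presentation of this code as row `GB126k28` (`Census/GB/GB126k28/{Cert,Distance}.lean`, qec-search-4 g4, p523202:
`GB126k28.isCode : (cert.code _).IsCode 126 28 8`, orbit-averaged information-set certificate, BOTH sides enumerated, KERNEL-std;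
census row `GB_l63_a0-1-14-16-22_b0-3-13-20-42`, kernel B certB 1acf475a2d54d5dc, job j257365).

CONVENTION.  The census generator file (qec-search-4, `census/search-4/gens/calib/GB_l63_a0-1-14-16-22_b0-3-13-20-42.json`) indexes the
circulants with the OPPOSITE sign to Bravyi et al. §4 / `BivariateBicycleCodes.lean`: its row `i` of `x^e` sits in column `i − e`.  Hence,
literally, `GB126k28.cert.HX = BBRows.rowsX la' lb'` for the NEGATED exponent lists `la' = −{0,1,14,16,22} = {0,62,49,47,41}`,
`lb' = −{0,3,13,20,42} = {0,60,50,43,21}` (`decide +kernel`; checked row-for-row in Python before filing), i.e. the census matrices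
ARE the flat check matrices of the typed code `BB.pk21A2.mapEquiv (AddEquiv.neg _)` = `GB(a(x⁻¹), b(x⁻¹))` (`BB.Code.mapEquiv`,
`TwoBlockCodeEquivalences.lean`: transport along the additive automorphism `g ↦ −g` of `ℤ₆₃ × ℤ₁`).  The parameters of
`C.mapEquiv φ` and `C` agree (`BB.Code.mapEquiv_dZ`, `mapEquiv_k` — Lin–Pryadko 2024 Thm 6(i), proved there), so the row transports to
`BB.pk21A2` itself:

* `negA`, `negB` — `(BB.pk21A2.mapEquiv φ).A = polyL la'`, `.B = polyL lb'` (`decide`);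
* `HX_eq_rowsX`, `HZ_eq_rowsZ`, `rowMatrix_HX_eq`, `rowMatrix_HZ_eq` — the kernel INDEX IDENTITIES (`BBRows.rowMatrix_rowsX/Z`);
* `neg_dZ`, `neg_k` — `d^Z = 8`, `k = 28` for `BB.pk21A2.mapEquiv φ` (`BB.Code.dZ_eq_of_flat` / `k_eq_of_flat` from `GB126k28.dZ_eq` / `k_eq`);
* `obj_dZ`, `obj_k` — the same for `BB.pk21A2` (`mapEquiv_dZ`, `mapEquiv_k`);
* **`PK21A2_28_8_holds : BB.HasParams BB.pk21A2 126 28 8`** (`Census/BB/Claims.lean`, distance EXACT = printed `8`) and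
  `isCode : BB.pk21A2.css.IsCode 126 28 8`.

No new certificate — tier KERNEL, axioms standard, no `native_decide`. HONEST FRAMING: a REPRODUCTION of the printed parameters
`[[126,28,8]]` on the typed object by an independent machine-checked certificate chain; no novelty word. Companion of `Census/GB/PK21A3.lean`
and of qec-search-2 g4's `PK21A5UB` / `PK21A1UB` / `PK21A6UB`. qec-search-2 g5.
-/

namespace Summit.Ventures.QEC.Census.PK21A2

open Matrix Literature.InformationTheory.QuantumCodes BBRows

/-- The additive automorphism `g ↦ −g` of `ℤ₆₃ × ℤ₁` (exponent inversion `x ↦ x⁻¹`). (definition) -/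
def φ : BB.Mono 63 1 ≃+ BB.Mono 63 1 := AddEquiv.neg (BB.Mono 63 1)

/-- The census row's literal typed object: `GB(a(x⁻¹), b(x⁻¹))` = `BB.pk21A2` transported along `φ`. (definition) -/
def neg : BB.Code 63 1 := BB.pk21A2.mapEquiv φ

/-- Monomials of `a(x⁻¹) = 1 + x⁴¹ + x⁴⁷ + x⁴⁹ + x⁶²` (`= −{0,1,14,16,22} mod 63`). DATA. -/
def la' : List (BB.Mono 63 1) :=
  [(Fin.ofNat 63 0, 0), (Fin.ofNat 63 62, 0), (Fin.ofNat 63 49, 0), (Fin.ofNat 63 47, 0), (Fin.ofNat 63 41, 0)]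

/-- Monomials of `b(x⁻¹) = 1 + x²¹ + x⁴³ + x⁵⁰ + x⁶⁰` (`= −{0,3,13,20,42} mod 63`). DATA. -/
def lb' : List (BB.Mono 63 1) :=
  [(Fin.ofNat 63 0, 0), (Fin.ofNat 63 60, 0), (Fin.ofNat 63 50, 0), (Fin.ofNat 63 43, 0), (Fin.ofNat 63 21, 0)]

/-- `neg.A = polyL la'` (pointwise on the 63 monomials, `decide`). -/
theorem negA : neg.A = polyL la' := by
  funext g; revert g; decide +kernel

/-- `neg.B = polyL lb'`. -/
theorem negB : neg.B = polyL lb' := by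
  funext g; revert g; decide +kernel

set_option maxRecDepth 100000 in
/-- INDEX IDENTITY, `X` side, in the kernel: the census certificate's `H^X` rows ARE the `X`-check words of `neg`
(`decide +kernel`). -/
theorem HX_eq_rowsX : GB126k28.cert.HX = rowsX la' lb' := by
  decide +kernel

set_option maxRecDepth 100000 in
/-- INDEX IDENTITY, `Z` side. -/
theorem HZ_eq_rowsZ : GB126k28.cert.HZ = rowsZ la' lb' := by
  decide +kernel

set_option maxRecDepth 100000 in
/-- The certificate's flat `H^X` is `neg.HXFlat`. -/
theorem rowMatrix_HX_eq : rowMatrix 126 GB126k28.cert.HX = neg.HXFlat := by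
  have cast : ∀ {H H' : List ℕ} (e : H = H'),
      rowMatrix 126 H = (rowMatrix 126 H').submatrix (Fin.cast (congrArg List.length e)) id := by
    intro H H' e; subst e; rfl
  exact (cast HX_eq_rowsX).trans (rowMatrix_rowsX neg (LA := la') (LB := lb') negA negB)

set_option maxRecDepth 100000 in
/-- The certificate's flat `H^Z` is `neg.HZFlat`. -/
theorem rowMatrix_HZ_eq : rowMatrix 126 GB126k28.cert.HZ = neg.HZFlat := by
  have cast : ∀ {H H' : List ℕ} (e : H = H'),
      rowMatrix 126 H = (rowMatrix 126 H').submatrix (Fin.cast (congrArg List.length e)) id := by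
    intro H H' e; subst e; rfl
  exact (cast HZ_eq_rowsZ).trans (rowMatrix_rowsZ neg (LA := la') (LB := lb') negA negB)

set_option maxRecDepth 100000 in
/-- `d^Z (neg) = 8`, transported from the census certificate (`GB126k28.dZ_eq`) by `BB.Code.dZ_eq_of_flat`. -/
theorem neg_dZ : neg.css.dZ = 8 :=
  (neg.dZ_eq_of_flat (D := GB126k28.cert.code (GB126k28.cert.commOK_of_checkStructure GB126k28.checkStructure_ok))
    rowMatrix_HX_eq rowMatrix_HZ_eq).symm.trans GB126k28.dZ_eq

set_option maxRecDepth 100000 in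
/-- `k (neg) = 28`, transported from the census certificate (`GB126k28.k_eq`) by `BB.Code.k_eq_of_flat`. -/
theorem neg_k : neg.k = 28 :=
  (neg.k_eq_of_flat (D := GB126k28.cert.code (GB126k28.cert.commOK_of_checkStructure GB126k28.checkStructure_ok))
    rowMatrix_HX_eq rowMatrix_HZ_eq).symm.trans GB126k28.k_eq

/-- `d^Z (BB.pk21A2) = 8` — parameters are invariant under `mapEquiv` (`BB.Code.mapEquiv_dZ`, Lin–Pryadko 2024 Thm 6(i)). -/
theorem obj_dZ : BB.pk21A2.css.dZ = 8 :=
  (BB.pk21A2.mapEquiv_dZ φ).symm.trans neg_dZ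

/-- `k (BB.pk21A2) = 28` (`BB.Code.mapEquiv_k`). -/
theorem obj_k : BB.pk21A2.k = 28 :=
  (BB.pk21A2.mapEquiv_k φ).symm.trans neg_k

/-- **Panteleev–Kalachev Table 1 row A2: `GB(1 + x + x¹⁴ + x¹⁶ + x²², 1 + x³ + x¹³ + x²⁰ + x⁴²)`, `ℓ = 63`, has parameters
`[[126, 28, 8]]`** (distance EXACT; `BB.HasParams`, the census predicate of `Census/BB/Claims.lean`) — the printed row REPRODUCED on the
typed object `BB.pk21A2`. KERNEL. -/
theorem PK21A2_28_8_holds : Summit.Ventures.QEC.BB.HasParams BB.pk21A2 126 28 8 :=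
  BB.hasParams_of_dZ (by simp only [BB.numQubits_eq]) obj_k obj_dZ

/-- The same in the generic census vocabulary: `BB.pk21A2.css.IsCode 126 28 8`. -/
theorem isCode : BB.pk21A2.css.IsCode 126 28 8 :=
  (BB.hasParams_iff_isCode (by decide)).1 PK21A2_28_8_holds

/-- Both one-sided distances of `BB.pk21A2` equal `8`. -/
theorem obj_dX_dZ : BB.pk21A2.css.dX = 8 ∧ BB.pk21A2.css.dZ = 8 :=
  BB.dX_eq_of_hasParams PK21A2_28_8_holds

end Summit.Ventures.QEC.Census.PK21A2
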